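import Summits.QuantumFields.YangMills.Theorems.BalabanUVNodesN06L3131HLegAtPinsPhysPU
import Summits.QuantumFields.YangMills.Theorems.BalabanUVNodesN06WELegAtPinsPhysPUB
import Literature.MathematicalPhysics.QuantumFieldTheory.Balaban1983to89.B9SmoothHolderClassStateProducers
import Literature.MathematicalPhysics.QuantumFieldTheory.Balaban1983to89.B9SmoothHolderClassStateDominated
import Literature.MathematicalPhysics.QuantumFieldTheory.Balaban1983to89.B9Thm312WholeStepDirRegular
import Literature.MathematicalPhysics.QuantumFieldTheory.Balaban1983to89.B9Thm33G0ProbeZeroAtCutPins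
import Literature.MathematicalPhysics.QuantumFieldTheory.Balaban1983to89.B9Thm312WholeStepFrom3131
import Literature.MathematicalPhysics.QuantumFieldTheory.Balaban1983to89.B9Thm313WholeDelta2LettersAtStatePrint
import Literature.MathematicalPhysics.QuantumFieldTheory.Balaban1983to89.B9Thm312WholeStepRegular
import Literature.MathematicalPhysics.QuantumFieldTheory.Balaban1983to89.B9MultiscaleSmoothPartitionYNear

/-!
# N06 [B9] — THE PRODUCER `G₀ : 𝔠⁽⁰⁾ → 𝔖₂` OF THE (3.138) STEP AT THE PINS (R-generic, U-variant)

T. Bałaban, *Propagators for lattice gauge theories in a background field*, Commun. Math. Phys. **99** (1985) 389–434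
[`Balaban1985BackgroundPropagators`, "B9"], Thm 3.3 p. 399, (3.42)–(3.43) pp. 397–398, p. 398 (remark after (3.47)), (3.130) p. 421, (3.138) p. 423;
[4] = T. Bałaban, *Propagators and renormalization transformations for lattice gauge theories. II*, Commun. Math. Phys. **96** (1984) 223–250
[`Balaban1984PropagatorsII`], (2.51)–(2.54) pp. 232–233, Lemma 2.1 (2.60)–(2.61) p. 234.

U8 STEP 2b-A₀ (director №272 (5), dag-n06-l KNIT v2): the initial state of print's induction over (3.138) — `G₀ : cNorm blk 0 → 𝔖₂(x,U)`,
𝔖₂(x,U) := `weightNorm (bXH x U) (rwt (geo9Y x) (−1)) _` — at the certificate's pins, member-uniformly, from Theorem 3.3's (3.42)₁ for G₀ (`he0`, read by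
`hasMaj_G0_cNorm`) and its component derivatives (`he1d`, giving the probe family `Φ^X_s∘G₀` along U(Γ) by dag-n06-w6's `pX0_of_pins` at the pin
`h𝔭A` with `parB = parBY`), through g26's `hasMaj_into_state_of_sup_probes_zero`.  The `hG0` input of `stepS_of_lettersS` and the `A₀` producer of `hstate2`.

HONEST LABEL: helper toward the U8 re-leaf; `he0 he1d` are HYPOTHESES of printed species (Theorem 3.3 for G₀); count-neutral; N06 NOT discharged; K1⁹ NOT closed;
nothing continuum ∕ OS ∕ mass gap ∕ Clay.  Cell `pub-ymgap` (HUMAN RULING D-0062), Track A node N06 [B9], seat `pub-ymgap-dag-n06-d` (g17), 2026-08-29.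
NEW file; nothing landed is modified.
-/

noncomputable section

namespace Summit.QuantumFields.YangMills.BalabanUVNodes.N06StateProducerG0AtPinsPU

open Literature.MathematicalPhysics.QuantumFieldTheory.Balaban1983to89
open Literature.MathematicalPhysics.QuantumFieldTheory.Balaban1983to89.Node00 (FBondY IBondY SiteY CfgY SiteParY SiteOpY parSymY GpY GpPhysY BondOpY toKT)
open Literature.MathematicalPhysics.QuantumFieldTheory.Balaban1983to89.Node00.OpsYSectDCoords (DvcoKH DvscoKH TpicoK T2coK cR39_trBasis_pos)
open B9Thm39ReadingCoords (cR39)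
open B9Thm34Ext (toB6)
open B11SectG (HasMaj BlockNorm RowSum)
open B9Thm312Whole (cNorm GeoOK)
open B9Thm312WholeClasses (cNormR rwt rwt_nonneg)
open B9RWSums343to347Whole (Facts347)
open B9CoReadingCoords (XBK blkBK)
open B9CoReadingCoordsS (XSK sIK blkSK GcoS)
open B9CoReadingCoordsH (XHK)
open B9CoReadingCoordsTranspose (TrIdx trBasis)
open B9PinMembersKLevelV1 (MemberY geo9Y)
open B9BackgroundsKLevelV1R (RegFamY bg9YR MemOfFam)
open B9GeoLemma21KLevelV1 (geo9Y_len_pos geo9Y_dist_triangle geo9Y_dist_comm rowSum261_geo9Y)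
open B9GeoNormsKLevelV1 (geo9K geo9K_dist_nonneg)
open B7Prop2SpecialUnitary (specialUnitaryUnits)
open B9PerturbationMajorantAlgebra (Proj349Maj Thm31GpMaj hasMaj_weaken)
open B9PerturbationMajorantsAtLetters (PcoK)
open B9MultiscaleSmoothPartitionYNear (rNear dist_sIK_le_of_nearY)
open B9SmoothHolderClassP (bHZKP bHZKPG bHZPG)
open B9GradViaDivLettersTransported (taxiB taxiS)
open B9PerturbationSplitAtLetters (TaLcoK TbLcoKH Ta2LcoK Tb2LcoKH tpi_t2_splitL_of_pins)
open B9PerturbationL2Delta2 (D2coK)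
open B9SmoothHolderClassPProducers (CTel CTel_nonneg CTel_mono CTel_mul)
open B9SmoothHolderClassTClosure (abs_cf_eq_nKT)
open B9RWSums347DefiniteFaces (geo9Y_scalars exp261 facts347_exp261_geo9Y)
open B9RowSum261DefiniteFaces (rowConst261 rowConst261_nonneg rowConst261_spec_of_rowSum261)
open B9SectDSup (weightNorm)
open B6RandomWalk (HasMajorant)
open B9Thm312WholeStepRegular (LettersS3131)
open B9Thm313WholeDelta2LettersAtStatePrint (ta2S_pins_print_of_h44G tb₂HS_pins_print_of_h43 hasMaj_state_of_raw_two)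
open Summit.QuantumFields.YangMills.BalabanUVNodes.N06HolderPinsGradedAtRecord (links_le_one)
open B6Prop22KLevelTorusCensusEta (nKT)
open B6GlobalChartV1 (PV blkV1) open B6Ineq2142KLevelV1 (β lvl) open B6Geom246MultiLevelTorus (geomT)
open scoped Matrix.Norms.L2Operator

open B9SmoothHolderClassState (hasMaj_id_state)
open B9SmoothHolderClassStateProducers (hasMaj_into_state_of_sup_probes)
open B9SmoothHolderClassStateDominated (exists_state_loc_le_sum)
open B9Thm312WholeStepDirRegular (readS_up)
open B9SectDSup (weightNorm_κ weightNorm_loc)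
open B9CoReadingCoordsHolder (PK blkPK probeK wK w₀K)
open B9CoReadingCoordsHolderAdm (wKA holderProbesKA)
open B9RWSums343Holder (HolderProbes)
open B9MultiscaleSmoothPartitionYLip (CLip)
open Summit.QuantumFields.YangMills.BalabanUVNodes.N06WELegAtPinsPhysPUB (hκX_of_pinsP)
open Literature.MathematicalPhysics.QuantumFieldTheory.Balaban1983to89.Node00 (parBY BondParY)

open B9SmoothHolderClassStateProducers (hasMaj_into_state_of_sup_probes_zero)
open B9Thm33G0ProbeZeroAtCutPins (pX0_of_pins)
open B9Thm312WholeStepFrom3131 (hasMaj_G0_cNorm)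
open B9CoReadingCoords (coordOpK cdBₗ)
open B9Thm39ReadingCoords (coordBound39 basisBound39)
open B6RandomWalkHom (HasMajorantHom)
open B9CoReadingCoordsHolder (PK blkPK probeK wK w₀K)
open B9CoReadingCoordsHolderAdm (wKA holderProbesKA)
open B9RWSums343Holder (HolderProbes)
open Literature.MathematicalPhysics.QuantumFieldTheory.Balaban1983to89.Node00 (parBY BondParY)

variable {N : ℕ} {d ℓ : ℕ} {hd : 1 ≤ d + 1} {hL : Odd (ℓ + 1) ∧ 1 < ℓ + 1} {b₀ b₁ : ℝ} {Mstar : ℕ}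

/-- ★★★ **THE PRODUCER `G₀ : 𝔠⁽⁰⁾ → 𝔖₂` AT THE PINS** (module docstring): member-uniformly in `x`, for `M ≥ M_T`, `Mα₀ ≤ a₀`, U ∈ (3.35)–(3.36):
`HasMaj (cNorm blk 0) 𝔖₂(x,U) (G₀ U) (A₀·e^{−δ_S d})` for `δ_S + 2τ ≤ δ₀` and the closed constant `hA₀`.
[cite: Balaban1985BackgroundPropagators, Thm 3.3 p.399, (3.42)–(3.43) pp.397–398, p.398 (remark after (3.47)), (3.138) p.423; Balaban1984PropagatorsII, (2.51)–(2.54) pp.232–233, Lemma 2.1 (2.60) p.234] -/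
theorem hG0S2_of_pinsP_geo9Y [NeZero N] [∀ x : MemberY d ℓ hd hL b₀ b₁ Mstar, Fintype (geo9Y x).Site]
    {R₁ R₂ : RegFamY d ℓ hd hL b₀ b₁ Mstar (Matrix (Fin N) (Fin N) ℂ)} (H : MemberY d ℓ hd hL b₀ b₁ Mstar → Prop)
    (bI : ∀ x : MemberY d ℓ hd hL b₀ b₁ Mstar, FBondY x.toKIdx → IBondY x.toKIdx)
    (hlev : ∀ (x : MemberY d ℓ hd hL b₀ b₁ Mstar) (f : FBondY x.toKIdx), lvl x.hN x.D x.hk (bI x f) = (blkV1 x.hN x.D f).1.1)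
    (hβ1 : ∀ (x : MemberY d ℓ hd hL b₀ b₁ Mstar) (f : FBondY x.toKIdx), (geomT x.D).dist (β x.hN x.D x.hk (bI x f)) (blkV1 x.hN x.D f) ≤ 1)
    (hbI0 : ∀ (x : MemberY d ℓ hd hL b₀ b₁ Mstar) (f : FBondY x.toKIdx), bI x f = bI x ⟨f.src, 0⟩)
    (hGR : MemOfFam (specialUnitaryUnits (Fin N)) R₁) (c : ℝ) {M₀ a₀ : ℝ} {τ : ℝ} (hτ : 0 < τ)
    (wX : ℝ → ℝ) (hwX₀ : ∀ s, 0 ≤ wX s) (hwX₁ : ∀ s, wX s ≤ 1)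
    (bXH : ∀ x : MemberY d ℓ hd hL b₀ b₁ Mstar, (bg9YR (Matrix (Fin N) (Fin N) ℂ) (specialUnitaryUnits (Fin N)) R₁ R₂ x).Cfg → BlockNorm (toB6 (geo9Y x) 1 (H x)) (XBK (TrIdx N) x.toKIdx → ℝ))
    (hbXH : ∀ (x : MemberY d ℓ hd hL b₀ b₁ Mstar) (U : (bg9YR (Matrix (Fin N) (Fin N) ℂ) (specialUnitaryUnits (Fin N)) R₁ R₂ x).Cfg), bXH x U =
      letI : Fintype (geo9K x.toKIdx).Site := (inferInstance : Fintype (geo9Y x).Site);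
      bHZKPG (κ := TrIdx N) x.toKIdx (trBasis N) (taxiB x.toKIdx (bg9YR (Matrix (Fin N) (Fin N) ℂ) (specialUnitaryUnits (Fin N)) R₁ R₂ x) (fun U => U) U) (R := (1 : ℝ)) (H := H x) wX hwX₀ hwX₁)
    (𝔬12 : ∀ x : MemberY d ℓ hd hL b₀ b₁ Mstar, B9Thm312Whole.Ops (geo9Y x) (bg9YR (Matrix (Fin N) (Fin N) ℂ) (specialUnitaryUnits (Fin N)) R₁ R₂ x) (XBK (TrIdx N) x.toKIdx) (XBK (TrIdx N) x.toKIdx) (XHK (TrIdx N) x.toKIdx) (XSK (TrIdx N) x.toKIdx))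
    (hblk12 : ∀ x : MemberY d ℓ hd hL b₀ b₁ Mstar, (𝔬12 x).blk = blkBK x.toKIdx (bI x))
    (𝔭A : ∀ x : MemberY d ℓ hd hL b₀ b₁ Mstar, HolderProbes (geo9Y x) (bg9YR (Matrix (Fin N) (Fin N) ℂ) (specialUnitaryUnits (Fin N)) R₁ R₂ x) (XBK (TrIdx N) x.toKIdx) (XBK (TrIdx N) x.toKIdx) (PK (FBondY x.toKIdx) (Fin (d + 1)) (TrIdx N)) (PK (FBondY x.toKIdx) (Fin (d + 1)) (TrIdx N)))
    {parB : ∀ x : MemberY d ℓ hd hL b₀ b₁ Mstar, BondParY (Matrix (Fin N) (Fin N) ℂ) x.toKIdx} (hparB : ∀ x : MemberY d ℓ hd hL b₀ b₁ Mstar, parB x = parBY x.toKIdx)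
    (h𝔭A : ∀ x : MemberY d ℓ hd hL b₀ b₁ Mstar, 𝔭A x = holderProbesKA x.toKIdx (trBasis N) (bg9YR (Matrix (Fin N) (Fin N) ℂ) (specialUnitaryUnits (Fin N)) R₁ R₂ x) (fun U => U) (parB x) (bI x))
    (Dd : ∀ x : MemberY d ℓ hd hL b₀ b₁ Mstar, (bg9YR (Matrix (Fin N) (Fin N) ℂ) (specialUnitaryUnits (Fin N)) R₁ R₂ x).Cfg → Fin (d + 1) → Module.End ℝ (XBK (TrIdx N) x.toKIdx → ℝ))
    (hDd : ∀ (x : MemberY d ℓ hd hL b₀ b₁ Mstar) (U : (bg9YR (Matrix (Fin N) (Fin N) ℂ) (specialUnitaryUnits (Fin N)) R₁ R₂ x).Cfg), Dd x U = fun μ => coordOpK (trBasis N) (fun _ : Fin (d + 1) => cdBₗ x.toKIdx U μ))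
    {B₀ δ₀ δS A₀ : ℝ} (hB₀ : 0 ≤ B₀) (hδS : 0 ≤ δS) (hδS₀ : δS + 2 * τ ≤ δ₀)
    (hA₀ : (((ℓ + 1 : ℕ) : ℝ)) * (B₀ * (((ℓ + 1 : ℕ) : ℝ)) + (coordBound39 (trBasis N) * ((d : ℝ) + 1) * basisBound39 (trBasis N) * B₀ * ((ℓ : ℝ) + 1) * Real.exp (δ₀ * (((d : ℝ) + 1) * (((ℓ : ℝ) + 1) + 1) + 2)) + B₀ + coordBound39 (trBasis N) * basisBound39 (trBasis N) * B₀) * (((ℓ + 1 : ℕ) : ℝ))) * Real.exp ((δS + τ) * (rNear d ℓ + 1)) * (((ℓ + 1 : ℕ) : ℝ)) ≤ A₀)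
    (he0 : ∀ x : MemberY d ℓ hd hL b₀ b₁ Mstar, M₀ ≤ (geo9Y x).M → ∀ α₀ : ℝ, 0 < α₀ → (geo9Y x).M * α₀ ≤ a₀ → ∀ U : (bg9YR (Matrix (Fin N) (Fin N) ℂ) (specialUnitaryUnits (Fin N)) R₁ R₂ x).Cfg, (bg9YR (Matrix (Fin N) (Fin N) ℂ) (specialUnitaryUnits (Fin N)) R₁ R₂ x).Reg335 c α₀ U → (bg9YR (Matrix (Fin N) (Fin N) ℂ) (specialUnitaryUnits (Fin N)) R₁ R₂ x).Reg336 c α₀ U →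
      HasMajorant (g := toB6 (geo9Y x) 1 (H x)) (𝔬12 x).blk ((𝔬12 x).G0 U) (fun (a b : (geo9Y x).Site) => B₀ * (geo9Y x).len a ^ 2 * Real.exp (-(δ₀ * (geo9Y x).dist a b))))
    (he1d : ∀ x : MemberY d ℓ hd hL b₀ b₁ Mstar, M₀ ≤ (geo9Y x).M → ∀ α₀ : ℝ, 0 < α₀ → (geo9Y x).M * α₀ ≤ a₀ → ∀ U : (bg9YR (Matrix (Fin N) (Fin N) ℂ) (specialUnitaryUnits (Fin N)) R₁ R₂ x).Cfg, (bg9YR (Matrix (Fin N) (Fin N) ℂ) (specialUnitaryUnits (Fin N)) R₁ R₂ x).Reg335 c α₀ U → (bg9YR (Matrix (Fin N) (Fin N) ℂ) (specialUnitaryUnits (Fin N)) R₁ R₂ x).Reg336 c α₀ U → ∀ μ : Fin (d + 1),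
      HasMajorantHom (g := toB6 (geo9Y x) 1 (H x)) (𝔬12 x).blk (𝔬12 x).blk (Dd x U μ ∘ₗ (𝔬12 x).G0 U)
        (fun (a b : (geo9Y x).Site) => B₀ * (geo9Y x).len a * Real.exp (-(δ₀ * (geo9Y x).dist a b)))) :
    ∃ MT : ℝ, ∀ x : MemberY d ℓ hd hL b₀ b₁ Mstar, MT ≤ (geo9Y x).M → ∀ α₀ : ℝ, 0 < α₀ → (geo9Y x).M * α₀ ≤ a₀ → ∀ U : (bg9YR (Matrix (Fin N) (Fin N) ℂ) (specialUnitaryUnits (Fin N)) R₁ R₂ x).Cfg, (bg9YR (Matrix (Fin N) (Fin N) ℂ) (specialUnitaryUnits (Fin N)) R₁ R₂ x).Reg335 c α₀ U → (bg9YR (Matrix (Fin N) (Fin N) ℂ) (specialUnitaryUnits (Fin N)) R₁ R₂ x).Reg336 c α₀ U →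
      HasMaj (cNorm 1 (H x) (𝔬12 x).blk (fun y => (geo9Y_len_pos x y).le) 0) (weightNorm (bXH x U) (rwt (geo9Y x) (-1)) (rwt_nonneg (fun y => (geo9Y_len_pos x y).le) (-1))) ((𝔬12 x).G0 U)
        (fun a b => A₀ * Real.exp (-(δS * (geo9Y x).dist a b))) := by
  obtain ⟨Mg, hFa⟩ := facts347_exp261_geo9Y (d := d) (ℓ := ℓ) (hd := hd) (hL := hL) (b₀ := b₀) (b₁ := b₁) (Mstar := Mstar) H (α := 1 / 2) (δ := 2 * τ)
    (by norm_num) (by norm_num) (by linarith)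
  have hτe : (1 : ℝ) / 2 * (2 * τ) = τ := by ring
  refine ⟨max M₀ Mg, fun x hM α₀ hα ha U hU hU' => ?_⟩
  letI : Fintype (geo9K x.toKIdx).Site := (inferInstance : Fintype (geo9Y x).Site)
  have hM0 : M₀ ≤ (geo9Y x).M := (le_max_left _ _).trans hM
  have hFax := hFa x ((le_max_right _ _).trans hM)
  have hG : GeoOK (geo9Y x) := ⟨geo9Y_dist_triangle x, geo9Y_dist_comm x, geo9K_dist_nonneg x.toKIdx, geo9Y_len_pos x⟩
  have hcf := abs_cf_eq_nKT x.toKIdx x.hcfk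
  have hLxK : (geo9K x.toKIdx).L ≤ (((ℓ + 1 : ℕ) : ℝ)) := (geo9Y_scalars x).2.1
  have hLx : (geo9Y x).L ≤ (((ℓ + 1 : ℕ) : ℝ)) := (geo9Y_scalars x).2.1
  have hL0K : 0 ≤ (geo9K x.toKIdx).L := le_trans zero_le_one hFax.one_le_L
  have hδ₀ : 0 ≤ δ₀ := by linarith
  have hCst : 0 ≤ (coordBound39 (trBasis N) * ((d : ℝ) + 1) * basisBound39 (trBasis N) * B₀ * ((ℓ : ℝ) + 1) * Real.exp (δ₀ * (((d : ℝ) + 1) * (((ℓ : ℝ) + 1) + 1) + 2)) + B₀ + coordBound39 (trBasis N) * basisBound39 (trBasis N) * B₀) := by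
    have h1 : 0 ≤ coordBound39 (trBasis N) := norm_nonneg _
    have h2 : 0 ≤ basisBound39 (trBasis N) := Finset.sum_nonneg fun _ _ => norm_nonneg _
    positivity
  -- the sup word and the probe family of G₀ at the pin
  have he0x := he0 x hM0 α₀ hα ha U hU hU'
  have he1x := he1d x hM0 α₀ hα ha U hU hU'
  rw [hblk12 x] at he0x he1x
  have hsup := hasMaj_G0_cNorm (R₀ := (1 : ℝ)) (H₀ := H x) hG hB₀ he0x
  have hpr : ∀ s : ℝ, 0 < s → s < 1 →
      HasMaj (cNormR 1 (H x) (blkBK x.toKIdx (bI x)) hG.lenle 0) (cNormR 1 (H x) (blkPK (bI x)) hG.lenle (s - 2))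
        (probeK (trBasis N) (taxiB x.toKIdx (bg9YR (Matrix (Fin N) (Fin N) ℂ) (specialUnitaryUnits (Fin N)) R₁ R₂ x) (fun U => U) U) (wKA x.toKIdx s) (w₀K x.toKIdx s) ∘ₗ (𝔬12 x).G0 U)
        (fun a a' => (coordBound39 (trBasis N) * ((d : ℝ) + 1) * basisBound39 (trBasis N) * B₀ * ((ℓ : ℝ) + 1) * Real.exp (δ₀ * (((d : ℝ) + 1) * (((ℓ : ℝ) + 1) + 1) + 2)) + B₀ + coordBound39 (trBasis N) * basisBound39 (trBasis N) * B₀) * Real.exp (-(δ₀ * (geo9K x.toKIdx).dist a a'))) := by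
    intro s hs0 hs1
    have h := pX0_of_pins x.toKIdx (trBasis N) hG (fun U : (bg9YR (Matrix (Fin N) (Fin N) ℂ) (specialUnitaryUnits (Fin N)) R₁ R₂ x).Cfg => U) (hparB x) U (links_le_one hGR x hU) (hlev x) (hβ1 x) (h𝔭A x) rfl (hDd x U) hG.lenle
      ((𝔬12 x).G0 U) hB₀ hδ₀ he0x he1x hs1.le
    rw [h𝔭A x, hparB x] at h
    exact h
  have hG0 := hasMaj_into_state_of_sup_probes_zero x.toKIdx (trBasis N) (taxiB x.toKIdx (bg9YR (Matrix (Fin N) (Fin N) ℂ) (specialUnitaryUnits (Fin N)) R₁ R₂ x) (fun U => U) U) (R := (1 : ℝ)) (H := H x) wX hwX₀ hwX₁ hG hFax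
    (hβ1 x) (hlev x) (hbI0 x) hcf (T := (𝔬12 x).G0 U) hB₀ hCst (fun s _ _ => hCst)
    (fun s _ _ => (mul_le_of_le_one_left hCst (hwX₁ s))) (δ := δS + τ) (by linarith)
    (show δS + τ + 1 / 2 * (2 * τ) ≤ δ₀ by linarith) (show δS + τ + 1 / 2 * (2 * τ) ≤ δ₀ by linarith) hsup hpr
  rw [hτe, show δS + τ - τ = δS by ring, ← hblk12 x] at hG0
  rw [hbXH x U]
  refine hG0.mono fun a b => mul_le_mul_of_nonneg_right ?_ (Real.exp_nonneg _)
  calc _ ≤ (((ℓ + 1 : ℕ) : ℝ)) * (B₀ * (((ℓ + 1 : ℕ) : ℝ)) + (coordBound39 (trBasis N) * ((d : ℝ) + 1) * basisBound39 (trBasis N) * B₀ * ((ℓ : ℝ) + 1) * Real.exp (δ₀ * (((d : ℝ) + 1) * (((ℓ : ℝ) + 1) + 1) + 2)) + B₀ + coordBound39 (trBasis N) * basisBound39 (trBasis N) * B₀) * (((ℓ + 1 : ℕ) : ℝ))) * Real.exp ((δS + τ) * (rNear d ℓ + 1)) * (((ℓ + 1 : ℕ) : ℝ)) := by gcongr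
    _ ≤ A₀ := hA₀

end Summit.QuantumFields.YangMills.BalabanUVNodes.N06StateProducerG0AtPinsPU

end
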